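import Literature.NumberTheory.Automorphic.UnitaryDualPairDoubledLineStabiliser
import Literature.NumberTheory.Automorphic.DoubledUnitaryRankOneReductionDiag
import HarnessLib

/-!
# The adelic `W`-side of the doubled pair acts on `𝕎□_𝔸 = 𝕎 ⊕ 𝕎⁻` by its `E`-scalar `2 × 2` matrix

Topic `NumberTheory/Automorphic`; namespace `Literature.NumberTheory.Automorphic.UnitaryGroup` (sequel of
`UnitaryDualPairDoubledLineStabiliser` §4).  KERNEL only: proved theorems, no definition, no named fact.

For the unitary dual pair `(U(J_V), U(J_{W□}))` with `dim_E W□ = 1 + 1` (the DOUBLED line `W ⊕ W⁻` of the doubling method, or any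
`2 × 2` hermitian `T_{W□}` over `F`), the pair embedding `ι = toSp` of ★ `GelbartRogawski1991.UnitaryDualPairSplittingDatum` in the
doubled enumeration `eD` (`(i,0) ↦ inl (e (i,0))`, `(i,1) ↦ inr (e (i,0))`, then `finSumFinEquiv`; ★ `UnitaryDualPairDoubledLineFrames`)
sends an ADELIC element `1_V ⊗ A`, `A ∈ U(T_{W□})(𝔸_F) ≤ GL₂(𝔸_E)`, to the symplectic automorphism of
`𝕎□_𝔸 = 𝔸_F^{n+n} × 𝔸_F^{n+n}` which, read on the two copies `(w₁, w₂) ∈ 𝕎 ⊕ 𝕎⁻` (`w_j = (x_j, y_j)`, `x_j, y_j ∈ 𝔸_F^n` the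
quadratic coordinates), is THE `E`-SCALAR MATRIX `A`: `w_j ↦ Σ_k A_{jk} · w_k`, where an `E ⊗ 𝔸_F`-scalar `p + q δ` acts on
`w = (x, y)` by `(p x + d q y, q x + p y)` (`δ² = d`).

* §1 **`toSp_adelicInr_apply_reindexW_sumElim`** — the formula, with `P = re_𝔸 ∘ A`, `Q = im_𝔸 ∘ A` entered as hypotheses
  (★ `toSp_apply`, ★ `IsQuadraticCoordinates.resAut_apply_mk` for the ADELIC quadratic coordinates ★ `quadraticAdeleEquiv`,
  ★ `one_kronecker_mulVec`, ★ `doubledFrame_apply_zero/one`); p08's ★ `coe_toSp_doubled_eq_spReindex_spSum` is the rational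
  block-diagonal case `A = γ ⊕ 1`;
* §2 corollaries for the RANK-ONE doubled line `T_W ⊕ −T_W` and the elements of ★ `DoubledUnitaryRankOneReductionDiag`:
  `toSp_adelicInr_cayley_conj_glDiagonal_apply` — the Levi element `d(u,w) = M·diag(u,w)·M⁻¹ = ½·!![u+w, u−w; u−w, u+w]` acts by
  `(w₁, w₂) ↦ (½(u(w₁+w₂) + w(w₁−w₂)), ½(u(w₁+w₂) − w(w₁−w₂)))` (the vector hypothesis `hD` of the geometric-frame Borel laws), and
  `toSp_adelicInr_cayley_conj_diag_posRealIdele_apply` — on the REAL RAY `u = z_E(r)`, `w = z_E(r)⁻¹` the imaginary parts vanish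
  and the real parts are the `F`-idele scalars `z_F(r)^{±1}` (★ `AdeleRing.ideleBaseChange_posRealIdele`).

References: S. Gelbart, I. Piatetski-Shapiro, S. Rallis, LNM 1254 (1987), Part A §2 pp. 7–9; M. Harris, S. Kudla, W. Sweet,
J. AMS 9 (1996), §1 (1.2), (1.11); S. Kudla, Israel J. Math. 87 (1994), §1; S. Gelbart, J. Rogawski, Invent. Math. 105 (1991), §3.1.

Written for the Hodge-CM cell `pub/hodgecm-mathlib`, floor 0, crux H413 (stmt-HodgeConjecture-24833), E-2 child line
`F0_E2SiegelWeilWeilRange`, SW2c-BOUND rows (RED)/(L-D) (A-p16 (g18), 2026-08-31; A-p12 (g13) FILE 3 census item (5)).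
HC_CM is proved only modulo the printed citations until rung 0 closes; this file discharges none of them.
-/

set_option autoImplicit false

noncomputable section

open scoped Kronecker Matrix NNReal
open NumberField
open Literature.RepresentationTheory.HeisenbergGroup
open Literature.NumberTheory.Weil1964

namespace Literature.NumberTheory.Automorphic

namespace UnitaryGroup

/-- `Σ_{x : Fin (1+1)} f x = f 0 + f 1` (private plumbing). [folklore] -/
private theorem sum_univ_fin_one_add_one' {M : Type*} [AddCommMonoid M] (f : Fin (1 + 1) → M) : ∑ x, f x = f 0 + f 1 :=
  Fin.sum_univ_two f

/-! ## §1 `ι_{eD}(1 ⊗ A)` acts on `(w₁, w₂) ∈ 𝕎 ⊕ 𝕎⁻` by the `E`-scalar matrix `A` -/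

section AdelicAction

variable (F E : Type) [Field F] [NumberField F] [Field E] [NumberField E] [Algebra F E] [Algebra.IsQuadraticExtension F E]
  (c : E ≃ₐ[F] E) {δ : E} (hcδ : c δ = -δ) (hδ : δ ≠ 0) {d : F} (hd : δ * δ = algebraMap F E d)
  (N : ℕ) {n : ℕ} (e : Fin N × Fin 1 ≃ Fin n)
  {TV : Matrix (Fin N) (Fin N) F} {TW2 : Matrix (Fin (1 + 1)) (Fin (1 + 1)) F}
  (hV : TV.IsSymm) (hW2 : TW2.IsSymm)

/-- **`ι_{eD}(1 ⊗ A)` is the `E`-scalar matrix `A` on `𝕎 ⊕ 𝕎⁻`.**  For an ADELIC `A ∈ U(T_{W□})(𝔸_F) ≤ GL₂(𝔸_E)` with real and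
imaginary parts `P = re_𝔸 ∘ A`, `Q = im_𝔸 ∘ A ∈ M₂(𝔸_F)` (quadratic coordinates `𝔸_E = 𝔸_F ⊕ 𝔸_F δ`, `δ² = d`), the pair embedding of
`1_V ⊗ A` in the doubled enumeration `eD` acts on `𝕎□_𝔸`, read through `reindexW finSumFinEquiv` on the two copies
`w_j = (x_j, y_j)` (`j = 1, 2`), by `x_j ↦ Σ_k (P_{jk} x_k + d Q_{jk} y_k)`, `y_j ↦ Σ_k (Q_{jk} x_k + P_{jk} y_k)`.
[cite: GelbartRogawski1991, §3.1 p. 454] [cite: HarrisKudlaSweet1996, §1 (1.2)] -/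
theorem toSp_adelicInr_apply_reindexW_sumElim (A : adelic F E c (1 + 1) (TW2.map (algebraMap F E)))
    (P Q : Matrix (Fin (1 + 1)) (Fin (1 + 1)) (AdeleRing (𝓞 F) F))
    (hP : ((A : GL (Fin (1 + 1)) (AdeleRing (𝓞 E) E)) : Matrix (Fin (1 + 1)) (Fin (1 + 1)) (AdeleRing (𝓞 E) E)).map
      (QuadraticCoordinates.re (quadraticAdeleEquiv F E c hcδ hδ).toAddEquiv) = P)
    (hQ : ((A : GL (Fin (1 + 1)) (AdeleRing (𝓞 E) E)) : Matrix (Fin (1 + 1)) (Fin (1 + 1)) (AdeleRing (𝓞 E) E)).map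
      (QuadraticCoordinates.im (quadraticAdeleEquiv F E c hcδ hδ).toAddEquiv) = Q)
    (x₁ x₂ y₁ y₂ : Fin n → AdeleRing (𝓞 F) F) :
    ((GelbartRogawski1991.UnitaryDualPair.toSp F E c N (1 + 1)
          (((Equiv.prodCongr (Equiv.refl (Fin N)) finSumFinEquiv.symm).trans (Equiv.prodSumDistrib (Fin N) (Fin 1) (Fin 1))).trans
            ((Equiv.sumCongr e e).trans finSumFinEquiv))
          (TV.map (algebraMap F E)) (TW2.map (algebraMap F E)) hcδ hδ hd hV hW2 rfl rfl
          (adelicInr F E c N (1 + 1) (TV.map (algebraMap F E)) (TW2.map (algebraMap F E)) A) :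
          symplecticGroup (polar (Weil1964.adelicForm F (Fin (n + n))
            (GelbartRogawski1991.UnitaryDualPair.adelicGram F
              (((Equiv.prodCongr (Equiv.refl (Fin N)) finSumFinEquiv.symm).trans (Equiv.prodSumDistrib (Fin N) (Fin 1) (Fin 1))).trans
                ((Equiv.sumCongr e e).trans finSumFinEquiv)) TV TW2)))) :
        ((Fin (n + n) → AdeleRing (𝓞 F) F) × (Fin (n + n) → AdeleRing (𝓞 F) F)) ≃ₗ[AdeleRing (𝓞 F) F]
          ((Fin (n + n) → AdeleRing (𝓞 F) F) × (Fin (n + n) → AdeleRing (𝓞 F) F)))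
        (reindexW (AdeleRing (𝓞 F) F) (finSumFinEquiv : Fin n ⊕ Fin n ≃ Fin (n + n)) (Sum.elim x₁ x₂, Sum.elim y₁ y₂)) =
      reindexW (AdeleRing (𝓞 F) F) (finSumFinEquiv : Fin n ⊕ Fin n ≃ Fin (n + n))
        (Sum.elim (P 0 0 • x₁ + P 0 1 • x₂ + algebraMap F (AdeleRing (𝓞 F) F) d • (Q 0 0 • y₁ + Q 0 1 • y₂))
            (P 1 0 • x₁ + P 1 1 • x₂ + algebraMap F (AdeleRing (𝓞 F) F) d • (Q 1 0 • y₁ + Q 1 1 • y₂)),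
          Sum.elim (Q 0 0 • x₁ + Q 0 1 • x₂ + (P 0 0 • y₁ + P 0 1 • y₂))
            (Q 1 0 • x₁ + Q 1 1 • x₂ + (P 1 0 • y₁ + P 1 1 • y₂))) := by
  set eD : Fin N × Fin (1 + 1) ≃ Fin (n + n) :=
    (((Equiv.prodCongr (Equiv.refl (Fin N)) finSumFinEquiv.symm).trans (Equiv.prodSumDistrib (Fin N) (Fin 1) (Fin 1))).trans
      ((Equiv.sumCongr e e).trans finSumFinEquiv)) with heD
  have hD0 : ∀ i : Fin N, eD (i, 0) = finSumFinEquiv (Sum.inl (e (i, 0))) := fun i => by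
    change finSumFinEquiv ((((Equiv.prodCongr (Equiv.refl (Fin N)) finSumFinEquiv.symm).trans
      (Equiv.prodSumDistrib (Fin N) (Fin 1) (Fin 1))).trans (Equiv.sumCongr e e)) (i, 0)) = _
    rw [doubledFrame_apply_zero e i]
  have hD1 : ∀ i : Fin N, eD (i, 1) = finSumFinEquiv (Sum.inr (e (i, 0))) := fun i => by
    change finSumFinEquiv ((((Equiv.prodCongr (Equiv.refl (Fin N)) finSumFinEquiv.symm).trans
      (Equiv.prodSumDistrib (Fin N) (Fin 1) (Fin 1))).trans (Equiv.sumCongr e e)) (i, 1)) = _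
    rw [doubledFrame_apply_one e i]
  -- the real and imaginary parts of `1 ⊗ A`
  have hcoe : (((adelicInr F E c N (1 + 1) (TV.map (algebraMap F E)) (TW2.map (algebraMap F E)) A :
      adelicPair F E c N (1 + 1) (TV.map (algebraMap F E)) (TW2.map (algebraMap F E))) :
      GL (Fin N × Fin (1 + 1)) (AdeleRing (𝓞 E) E)) : Matrix (Fin N × Fin (1 + 1)) (Fin N × Fin (1 + 1)) (AdeleRing (𝓞 E) E)) =
      (1 : Matrix (Fin N) (Fin N) (AdeleRing (𝓞 E) E)) ⊗ₖ
        ((A : GL (Fin (1 + 1)) (AdeleRing (𝓞 E) E)) : Matrix (Fin (1 + 1)) (Fin (1 + 1)) (AdeleRing (𝓞 E) E)) := rfl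
  have hre : ((((adelicInr F E c N (1 + 1) (TV.map (algebraMap F E)) (TW2.map (algebraMap F E)) A :
      adelicPair F E c N (1 + 1) (TV.map (algebraMap F E)) (TW2.map (algebraMap F E))) :
      GL (Fin N × Fin (1 + 1)) (AdeleRing (𝓞 E) E)) : Matrix (Fin N × Fin (1 + 1)) (Fin N × Fin (1 + 1)) (AdeleRing (𝓞 E) E)).map
        (QuadraticCoordinates.re (quadraticAdeleEquiv F E c hcδ hδ).toAddEquiv)) =
      (1 : Matrix (Fin N) (Fin N) (AdeleRing (𝓞 F) F)) ⊗ₖ P := by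
    rw [hcoe, one_kronecker_map, hP]
  have him : ((((adelicInr F E c N (1 + 1) (TV.map (algebraMap F E)) (TW2.map (algebraMap F E)) A :
      adelicPair F E c N (1 + 1) (TV.map (algebraMap F E)) (TW2.map (algebraMap F E))) :
      GL (Fin N × Fin (1 + 1)) (AdeleRing (𝓞 E) E)) : Matrix (Fin N × Fin (1 + 1)) (Fin N × Fin (1 + 1)) (AdeleRing (𝓞 E) E)).map
        (QuadraticCoordinates.im (quadraticAdeleEquiv F E c hcδ hδ).toAddEquiv)) =
      (1 : Matrix (Fin N) (Fin N) (AdeleRing (𝓞 F) F)) ⊗ₖ Q := by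
    rw [hcoe, one_kronecker_map, hQ]
  -- unfold `toSp` to `resAut` on the pulled-back coordinates
  rw [GelbartRogawski1991.UnitaryDualPair.toSp_apply, coe_spReindex_apply]
  simp only [reindexW_apply, reindexW_symm_apply]
  set a : Fin N × Fin (1 + 1) → AdeleRing (𝓞 F) F := (Sum.elim x₁ x₂ ∘ ⇑(finSumFinEquiv : Fin n ⊕ Fin n ≃ Fin (n + n)).symm) ∘ ⇑eD
    with ha
  set b : Fin N × Fin (1 + 1) → AdeleRing (𝓞 F) F := (Sum.elim y₁ y₂ ∘ ⇑(finSumFinEquiv : Fin n ⊕ Fin n ≃ Fin (n + n)).symm) ∘ ⇑eD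
    with hb
  have happ : ((adelicPairToSymplectic F E c N (1 + 1) hcδ hδ hd hV hW2 rfl rfl
        (adelicInr F E c N (1 + 1) (TV.map (algebraMap F E)) (TW2.map (algebraMap F E)) A) :
        symplecticGroup (polar (Matrix.toLinearMap₂' (AdeleRing (𝓞 F) F)
          ((TV.map (algebraMap F (AdeleRing (𝓞 F) F))) ⊗ₖ (TW2.map (algebraMap F (AdeleRing (𝓞 F) F))))))) :
        ((Fin N × Fin (1 + 1) → AdeleRing (𝓞 F) F) × (Fin N × Fin (1 + 1) → AdeleRing (𝓞 F) F)) ≃ₗ[AdeleRing (𝓞 F) F]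
          ((Fin N × Fin (1 + 1) → AdeleRing (𝓞 F) F) × (Fin N × Fin (1 + 1) → AdeleRing (𝓞 F) F))) (a, b) =
      (((1 : Matrix (Fin N) (Fin N) (AdeleRing (𝓞 F) F)) ⊗ₖ P) *ᵥ a +
          algebraMap F (AdeleRing (𝓞 F) F) d • (((1 : Matrix (Fin N) (Fin N) (AdeleRing (𝓞 F) F)) ⊗ₖ Q) *ᵥ b),
        ((1 : Matrix (Fin N) (Fin N) (AdeleRing (𝓞 F) F)) ⊗ₖ Q) *ᵥ a +
          ((1 : Matrix (Fin N) (Fin N) (AdeleRing (𝓞 F) F)) ⊗ₖ P) *ᵥ b) := by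
    rw [← hre, ← him]
    exact (isQuadraticCoordinates_adele E c hcδ hδ hd).resAut_apply_mk (Fin N × Fin (1 + 1)) _ a b
  have ha0 : ∀ i : Fin N, a (i, 0) = x₁ (e (i, 0)) := fun i => by
    simp only [ha, Function.comp_apply, hD0, Equiv.symm_apply_apply, Sum.elim_inl]
  have ha1 : ∀ i : Fin N, a (i, 1) = x₂ (e (i, 0)) := fun i => by
    simp only [ha, Function.comp_apply, hD1, Equiv.symm_apply_apply, Sum.elim_inr]
  have hb0 : ∀ i : Fin N, b (i, 0) = y₁ (e (i, 0)) := fun i => by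
    simp only [hb, Function.comp_apply, hD0, Equiv.symm_apply_apply, Sum.elim_inl]
  have hb1 : ∀ i : Fin N, b (i, 1) = y₂ (e (i, 0)) := fun i => by
    simp only [hb, Function.comp_apply, hD1, Equiv.symm_apply_apply, Sum.elim_inr]
  rw [happ]
  refine Prod.ext (funext fun m => ?_) (funext fun m => ?_) <;>
    obtain ⟨⟨i, k⟩, rfl⟩ := eD.surjective m <;>
    fin_cases k <;>
    simp only [Fin.zero_eta, Fin.mk_one, Fin.isValue, Function.comp_apply, Equiv.symm_apply_apply] <;>
    simp only [hD0, hD1, Equiv.symm_apply_apply, Sum.elim_inl, Sum.elim_inr, Pi.add_apply, Pi.smul_apply, smul_eq_mul,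
      one_kronecker_mulVec, sum_univ_fin_one_add_one', ha0, ha1, hb0, hb1, Fin.isValue]

end AdelicAction

/-! ## §2 The rank-one doubled line: the Levi elements `d(u,w) = M·diag(u,w)·M⁻¹` and the real ray -/

section RankOne

variable (F E : Type) [Field F] [NumberField F] [Field E] [NumberField E] [Algebra F E] [Algebra.IsQuadraticExtension F E]
  (c : E ≃ₐ[F] E) {δ : E} (hcδ : c δ = -δ) (hδ : δ ≠ 0) {d : F} (hd : δ * δ = algebraMap F E d)
  (N : ℕ) {n : ℕ} (e : Fin N × Fin 1 ≃ Fin n)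
  {TV : Matrix (Fin N) (Fin N) F} (TW : Matrix (Fin 1) (Fin 1) F) (hV : TV.IsSymm)
  (hW2 : (Matrix.reindex finSumFinEquiv finSumFinEquiv (Matrix.fromBlocks TW 0 0 (-TW))).IsSymm)

/-- **The Levi element `d(u,w) = M·diag(u,w)·M⁻¹` of `U(T_W ⊕ −T_W)(𝔸)` acts on `(w₁, w₂) ∈ 𝕎 ⊕ 𝕎⁻` by
`(½(u(w₁+w₂) + w(w₁−w₂)), ½(u(w₁+w₂) − w(w₁−w₂)))`** — `u = p₁ + q₁δ` on the diagonal `W^Δ`, `w = p₂ + q₂δ` on `W^∇`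
(the vector hypothesis `hD` of the doubled-frame Borel laws; `M` the Cayley matrix of ★ `exists_cayleyTwo`).
[cite: HarrisKudlaSweet1996, §1 (1.11)] [cite: GelbartRogawski1991, §3.1 p. 454] -/
theorem toSp_adelicInr_cayley_conj_glDiagonal_apply (hTW : TW 0 0 ≠ 0) {M : GL (Fin 2) (AdeleRing (𝓞 E) E)}
    (hM : (M : Matrix (Fin 2) (Fin 2) (AdeleRing (𝓞 E) E)) =
      !![1, algebraMap E (AdeleRing (𝓞 E) E) (algebraMap F E (2 * TW 0 0)⁻¹);
        1, -algebraMap E (AdeleRing (𝓞 E) E) (algebraMap F E (2 * TW 0 0)⁻¹)])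
    (u w : (AdeleRing (𝓞 E) E)ˣ)
    (hA : M * glDiagonal 2 (AdeleRing (𝓞 E) E) ![u, w] * M⁻¹ ∈
      adelic F E c (1 + 1) ((Matrix.reindex finSumFinEquiv finSumFinEquiv (Matrix.fromBlocks TW 0 0 (-TW))).map (algebraMap F E)))
    (p₁ q₁ p₂ q₂ : AdeleRing (𝓞 F) F)
    (hp₁ : QuadraticCoordinates.re (quadraticAdeleEquiv F E c hcδ hδ).toAddEquiv (u : AdeleRing (𝓞 E) E) = p₁)
    (hq₁ : QuadraticCoordinates.im (quadraticAdeleEquiv F E c hcδ hδ).toAddEquiv (u : AdeleRing (𝓞 E) E) = q₁)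
    (hp₂ : QuadraticCoordinates.re (quadraticAdeleEquiv F E c hcδ hδ).toAddEquiv (w : AdeleRing (𝓞 E) E) = p₂)
    (hq₂ : QuadraticCoordinates.im (quadraticAdeleEquiv F E c hcδ hδ).toAddEquiv (w : AdeleRing (𝓞 E) E) = q₂)
    (x₁ x₂ y₁ y₂ : Fin n → AdeleRing (𝓞 F) F) :
    ((GelbartRogawski1991.UnitaryDualPair.toSp F E c N (1 + 1)
          (((Equiv.prodCongr (Equiv.refl (Fin N)) finSumFinEquiv.symm).trans (Equiv.prodSumDistrib (Fin N) (Fin 1) (Fin 1))).trans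
            ((Equiv.sumCongr e e).trans finSumFinEquiv))
          (TV.map (algebraMap F E)) ((Matrix.reindex finSumFinEquiv finSumFinEquiv (Matrix.fromBlocks TW 0 0 (-TW))).map (algebraMap F E))
          hcδ hδ hd hV hW2 rfl rfl
          (adelicInr F E c N (1 + 1) (TV.map (algebraMap F E))
            ((Matrix.reindex finSumFinEquiv finSumFinEquiv (Matrix.fromBlocks TW 0 0 (-TW))).map (algebraMap F E))
            ⟨M * glDiagonal 2 (AdeleRing (𝓞 E) E) ![u, w] * M⁻¹, hA⟩) :
          symplecticGroup (polar (Weil1964.adelicForm F (Fin (n + n))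
            (GelbartRogawski1991.UnitaryDualPair.adelicGram F
              (((Equiv.prodCongr (Equiv.refl (Fin N)) finSumFinEquiv.symm).trans (Equiv.prodSumDistrib (Fin N) (Fin 1) (Fin 1))).trans
                ((Equiv.sumCongr e e).trans finSumFinEquiv)) TV
              (Matrix.reindex finSumFinEquiv finSumFinEquiv (Matrix.fromBlocks TW 0 0 (-TW))))))) :
        ((Fin (n + n) → AdeleRing (𝓞 F) F) × (Fin (n + n) → AdeleRing (𝓞 F) F)) ≃ₗ[AdeleRing (𝓞 F) F]
          ((Fin (n + n) → AdeleRing (𝓞 F) F) × (Fin (n + n) → AdeleRing (𝓞 F) F)))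
        (reindexW (AdeleRing (𝓞 F) F) (finSumFinEquiv : Fin n ⊕ Fin n ≃ Fin (n + n)) (Sum.elim x₁ x₂, Sum.elim y₁ y₂)) =
      reindexW (AdeleRing (𝓞 F) F) (finSumFinEquiv : Fin n ⊕ Fin n ≃ Fin (n + n))
        (Sum.elim
            (⅟(2 : AdeleRing (𝓞 F) F) • ((p₁ • (x₁ + x₂) + algebraMap F (AdeleRing (𝓞 F) F) d • (q₁ • (y₁ + y₂))) +
                (p₂ • (x₁ - x₂) + algebraMap F (AdeleRing (𝓞 F) F) d • (q₂ • (y₁ - y₂)))))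
            (⅟(2 : AdeleRing (𝓞 F) F) • ((p₁ • (x₁ + x₂) + algebraMap F (AdeleRing (𝓞 F) F) d • (q₁ • (y₁ + y₂))) -
                (p₂ • (x₁ - x₂) + algebraMap F (AdeleRing (𝓞 F) F) d • (q₂ • (y₁ - y₂))))),
          Sum.elim
            (⅟(2 : AdeleRing (𝓞 F) F) • ((q₁ • (x₁ + x₂) + p₁ • (y₁ + y₂)) + (q₂ • (x₁ - x₂) + p₂ • (y₁ - y₂))))
            (⅟(2 : AdeleRing (𝓞 F) F) • ((q₁ • (x₁ + x₂) + p₁ • (y₁ + y₂)) - (q₂ • (x₁ - x₂) + p₂ • (y₁ - y₂))))) := by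
  -- real and imaginary parts of the four entries of `d(u,w) = ι(2⁻¹) · !![u+w, u−w; u−w, u+w]`
  have hq := isQuadraticCoordinates_adele E c hcδ hδ hd
  have hmat := DoubledUnitary.RankOneReduction.coe_cayley_conj_glDiagonal_adelic F E TW hTW hM u w
  have h2A : algebraMap F (AdeleRing (𝓞 F) F) 2⁻¹ = ⅟(2 : AdeleRing (𝓞 F) F) := by
    refine (invOf_eq_right_inv ?_).symm
    rw [show (2 : AdeleRing (𝓞 F) F) = algebraMap F (AdeleRing (𝓞 F) F) 2 from (map_ofNat _ 2).symm, ← map_mul,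
      mul_inv_cancel₀ (two_ne_zero : (2 : F) ≠ 0), map_one]
  have hhalf : algebraMap E (AdeleRing (𝓞 E) E) 2⁻¹ = AdeleRing.baseChange F E (⅟(2 : AdeleRing (𝓞 F) F)) := by
    rw [← h2A, AdeleRing.baseChange_algebraMap, map_inv₀ (algebraMap F E) 2, map_ofNat]
  have hreE : ∀ z : AdeleRing (𝓞 E) E, QuadraticCoordinates.re (quadraticAdeleEquiv F E c hcδ hδ).toAddEquiv
      (algebraMap E (AdeleRing (𝓞 E) E) 2⁻¹ * z) =
      ⅟(2 : AdeleRing (𝓞 F) F) * QuadraticCoordinates.re (quadraticAdeleEquiv F E c hcδ hδ).toAddEquiv z := fun z => by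
    rw [hhalf]; exact hq.re_map_mul _ z
  have himE : ∀ z : AdeleRing (𝓞 E) E, QuadraticCoordinates.im (quadraticAdeleEquiv F E c hcδ hδ).toAddEquiv
      (algebraMap E (AdeleRing (𝓞 E) E) 2⁻¹ * z) =
      ⅟(2 : AdeleRing (𝓞 F) F) * QuadraticCoordinates.im (quadraticAdeleEquiv F E c hcδ hδ).toAddEquiv z := fun z => by
    rw [hhalf]; exact hq.im_map_mul _ z
  have hP : ((M * glDiagonal 2 (AdeleRing (𝓞 E) E) ![u, w] * M⁻¹ : GL (Fin 2) (AdeleRing (𝓞 E) E)) :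
      Matrix (Fin 2) (Fin 2) (AdeleRing (𝓞 E) E)).map (QuadraticCoordinates.re (quadraticAdeleEquiv F E c hcδ hδ).toAddEquiv) =
      !![⅟(2 : AdeleRing (𝓞 F) F) * (p₁ + p₂), ⅟(2 : AdeleRing (𝓞 F) F) * (p₁ - p₂);
        ⅟(2 : AdeleRing (𝓞 F) F) * (p₁ - p₂), ⅟(2 : AdeleRing (𝓞 F) F) * (p₁ + p₂)] := by
    rw [hmat]
    ext i j
    fin_cases i <;> fin_cases j <;>
      simp only [Matrix.map_apply, Matrix.of_apply, Matrix.cons_val', Matrix.cons_val_zero, Matrix.cons_val_one,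
        Matrix.cons_val_fin_one, Matrix.empty_val', Fin.zero_eta, Fin.mk_one, Fin.isValue, hreE, map_add,
        map_sub, hp₁, hp₂]
  have hQ : ((M * glDiagonal 2 (AdeleRing (𝓞 E) E) ![u, w] * M⁻¹ : GL (Fin 2) (AdeleRing (𝓞 E) E)) :
      Matrix (Fin 2) (Fin 2) (AdeleRing (𝓞 E) E)).map (QuadraticCoordinates.im (quadraticAdeleEquiv F E c hcδ hδ).toAddEquiv) =
      !![⅟(2 : AdeleRing (𝓞 F) F) * (q₁ + q₂), ⅟(2 : AdeleRing (𝓞 F) F) * (q₁ - q₂);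
        ⅟(2 : AdeleRing (𝓞 F) F) * (q₁ - q₂), ⅟(2 : AdeleRing (𝓞 F) F) * (q₁ + q₂)] := by
    rw [hmat]
    ext i j
    fin_cases i <;> fin_cases j <;>
      simp only [Matrix.map_apply, Matrix.of_apply, Matrix.cons_val', Matrix.cons_val_zero, Matrix.cons_val_one,
        Matrix.cons_val_fin_one, Matrix.empty_val', Fin.zero_eta, Fin.mk_one, Fin.isValue, himE, map_add,
        map_sub, hq₁, hq₂]
  rw [toSp_adelicInr_apply_reindexW_sumElim F E c hcδ hδ hd N e hV hW2 ⟨_, hA⟩ _ _ hP hQ x₁ x₂ y₁ y₂]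
  congr 1
  refine Prod.ext ?_ ?_
  · refine funext fun s => ?_
    rcases s with j | j <;>
      simp only [Sum.elim_inl, Sum.elim_inr, Matrix.of_apply, Matrix.cons_val', Matrix.cons_val_zero, Matrix.cons_val_one,
        Matrix.cons_val_fin_one, Matrix.empty_val', Pi.add_apply, Pi.sub_apply, Pi.smul_apply, smul_eq_mul] <;>
      ring
  · refine funext fun s => ?_
    rcases s with j | j <;>
      simp only [Sum.elim_inl, Sum.elim_inr, Matrix.of_apply, Matrix.cons_val', Matrix.cons_val_zero, Matrix.cons_val_one,
        Matrix.cons_val_fin_one, Matrix.empty_val', Pi.add_apply, Pi.sub_apply, Pi.smul_apply, smul_eq_mul] <;>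
      ring

/-- **On the REAL RAY the Levi element acts by the `F`-idele scalars `z_F(r)^{±1}`**: for `u = z_E(r)`, `w = z_E(r)⁻¹` the
imaginary parts vanish and `ι_{eD}(1 ⊗ d(z_E r, z_E r⁻¹))` sends `(w₁, w₂)` to
`(½(z(w₁+w₂) + z⁻¹(w₁−w₂)), ½(z(w₁+w₂) − z⁻¹(w₁−w₂)))`, `z = z_F(r)` acting on both quadratic coordinates alike — a PURE LEVI
element in any frame adapted to `(W^∇, W^Δ)` (the input of the wide-ray/narrow-ray bookkeeping of the Siegel–Weil boundedness step).
[cite: HarrisKudlaSweet1996, §1 (1.11)] [cite: Weil1965, n° 47 Lemme 20 (p. 67)] -/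
theorem toSp_adelicInr_cayley_conj_diag_posRealIdele_apply (hTW : TW 0 0 ≠ 0) {M : GL (Fin 2) (AdeleRing (𝓞 E) E)}
    (hM : (M : Matrix (Fin 2) (Fin 2) (AdeleRing (𝓞 E) E)) =
      !![1, algebraMap E (AdeleRing (𝓞 E) E) (algebraMap F E (2 * TW 0 0)⁻¹);
        1, -algebraMap E (AdeleRing (𝓞 E) E) (algebraMap F E (2 * TW 0 0)⁻¹)])
    (r : ℝ≥0ˣ) (x₁ x₂ y₁ y₂ : Fin n → AdeleRing (𝓞 F) F) :
    ((GelbartRogawski1991.UnitaryDualPair.toSp F E c N (1 + 1)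
          (((Equiv.prodCongr (Equiv.refl (Fin N)) finSumFinEquiv.symm).trans (Equiv.prodSumDistrib (Fin N) (Fin 1) (Fin 1))).trans
            ((Equiv.sumCongr e e).trans finSumFinEquiv))
          (TV.map (algebraMap F E)) ((Matrix.reindex finSumFinEquiv finSumFinEquiv (Matrix.fromBlocks TW 0 0 (-TW))).map (algebraMap F E))
          hcδ hδ hd hV hW2 rfl rfl
          (adelicInr F E c N (1 + 1) (TV.map (algebraMap F E))
            ((Matrix.reindex finSumFinEquiv finSumFinEquiv (Matrix.fromBlocks TW 0 0 (-TW))).map (algebraMap F E))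
            ⟨M * glDiagonal 2 (AdeleRing (𝓞 E) E) ![posRealIdele E r, (posRealIdele E r)⁻¹] * M⁻¹,
              DoubledUnitary.RankOneReduction.cayley_conj_diag_posRealIdele_mem_adelic F E c TW hTW hM r⟩) :
          symplecticGroup (polar (Weil1964.adelicForm F (Fin (n + n))
            (GelbartRogawski1991.UnitaryDualPair.adelicGram F
              (((Equiv.prodCongr (Equiv.refl (Fin N)) finSumFinEquiv.symm).trans (Equiv.prodSumDistrib (Fin N) (Fin 1) (Fin 1))).trans
                ((Equiv.sumCongr e e).trans finSumFinEquiv)) TV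
              (Matrix.reindex finSumFinEquiv finSumFinEquiv (Matrix.fromBlocks TW 0 0 (-TW))))))) :
        ((Fin (n + n) → AdeleRing (𝓞 F) F) × (Fin (n + n) → AdeleRing (𝓞 F) F)) ≃ₗ[AdeleRing (𝓞 F) F]
          ((Fin (n + n) → AdeleRing (𝓞 F) F) × (Fin (n + n) → AdeleRing (𝓞 F) F)))
        (reindexW (AdeleRing (𝓞 F) F) (finSumFinEquiv : Fin n ⊕ Fin n ≃ Fin (n + n)) (Sum.elim x₁ x₂, Sum.elim y₁ y₂)) =
      reindexW (AdeleRing (𝓞 F) F) (finSumFinEquiv : Fin n ⊕ Fin n ≃ Fin (n + n))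
        (Sum.elim
            (⅟(2 : AdeleRing (𝓞 F) F) • ((((posRealIdele F r : (AdeleRing (𝓞 F) F)ˣ) : AdeleRing (𝓞 F) F) • (x₁ + x₂)) +
                (((posRealIdele F r)⁻¹ : (AdeleRing (𝓞 F) F)ˣ) : AdeleRing (𝓞 F) F) • (x₁ - x₂)))
            (⅟(2 : AdeleRing (𝓞 F) F) • ((((posRealIdele F r : (AdeleRing (𝓞 F) F)ˣ) : AdeleRing (𝓞 F) F) • (x₁ + x₂)) -
                (((posRealIdele F r)⁻¹ : (AdeleRing (𝓞 F) F)ˣ) : AdeleRing (𝓞 F) F) • (x₁ - x₂))),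
          Sum.elim
            (⅟(2 : AdeleRing (𝓞 F) F) • ((((posRealIdele F r : (AdeleRing (𝓞 F) F)ˣ) : AdeleRing (𝓞 F) F) • (y₁ + y₂)) +
                (((posRealIdele F r)⁻¹ : (AdeleRing (𝓞 F) F)ˣ) : AdeleRing (𝓞 F) F) • (y₁ - y₂)))
            (⅟(2 : AdeleRing (𝓞 F) F) • ((((posRealIdele F r : (AdeleRing (𝓞 F) F)ˣ) : AdeleRing (𝓞 F) F) • (y₁ + y₂)) -
                (((posRealIdele F r)⁻¹ : (AdeleRing (𝓞 F) F)ˣ) : AdeleRing (𝓞 F) F) • (y₁ - y₂)))) := by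
  have hq := isQuadraticCoordinates_adele E c hcδ hδ hd
  -- `z_E(r)^{±1} = baseChange (z_F(r)^{±1})`: real part `z_F(r)^{±1}`, imaginary part `0`
  have hu : ((posRealIdele E r : (AdeleRing (𝓞 E) E)ˣ) : AdeleRing (𝓞 E) E) =
      AdeleRing.baseChange F E ((posRealIdele F r : (AdeleRing (𝓞 F) F)ˣ) : AdeleRing (𝓞 F) F) := by
    rw [← AdeleRing.ideleBaseChange_posRealIdele F E r, AdeleRing.coe_ideleBaseChange]
  have hw : (((posRealIdele E r)⁻¹ : (AdeleRing (𝓞 E) E)ˣ) : AdeleRing (𝓞 E) E) =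
      AdeleRing.baseChange F E (((posRealIdele F r)⁻¹ : (AdeleRing (𝓞 F) F)ˣ) : AdeleRing (𝓞 F) F) := by
    rw [← AdeleRing.ideleBaseChange_posRealIdele F E r, ← map_inv, AdeleRing.coe_ideleBaseChange]
  rw [toSp_adelicInr_cayley_conj_glDiagonal_apply F E c hcδ hδ hd N e TW hV hW2 hTW hM (posRealIdele E r) (posRealIdele E r)⁻¹
    (DoubledUnitary.RankOneReduction.cayley_conj_diag_posRealIdele_mem_adelic F E c TW hTW hM r)
    ((posRealIdele F r : (AdeleRing (𝓞 F) F)ˣ) : AdeleRing (𝓞 F) F) 0 (((posRealIdele F r)⁻¹ : (AdeleRing (𝓞 F) F)ˣ) : AdeleRing (𝓞 F) F) 0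
    (by rw [hu]; exact hq.re_map _) (by rw [hu]; exact hq.im_map _) (by rw [hw]; exact hq.re_map _) (by rw [hw]; exact hq.im_map _)
    x₁ x₂ y₁ y₂]
  simp only [zero_smul, smul_zero, add_zero, zero_add]

end RankOne

end UnitaryGroup

end Literature.NumberTheory.Automorphic

end
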